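import Mathlib
import HarnessLib
import Literature.MathematicalPhysics.QuantumLattice.FermiRG.Salmhofer1998PropagatorBoundsProof
import Summits.HubbardSuperconductivity.HubbardSuperconductivity.Theorems.KLProgrammeFermiSurfaceSalmhofer1998

/-!
# Route `KLProgramme` (K3 `KLRegimeTwoPointLimit`, behind D1): Salmhofer 1998 PROPOSITION 4 — the finite-volume
# cutoff-propagator bounds — is a THEOREM for the Hubbard model at every `-4 < μ < 0`

Cell `gate-hubbard-kl`, seat fs-1 (g4), risk-register item r2 (census of typed hypothesis sets, FS-WINDOW.md §5,
row «Salmhofer 1998 §2.3»). The typer wave typed M. Salmhofer, *Continuous renormalization for fermions and Fermi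
liquid theory*, Commun. Math. Phys. 194 (1998) 249–295, §2.3 as the model class `Salmhofer1998.ModelData.Hyp`
(t7, `Salmhofer1998Sec2.lean`) and Proposition 4 (§5.3, the bounds on the finite-volume scale-decomposed
propagator `D̂_t` of (5.9): `C^∞` in `t`; `≡ 0` beyond `t = log(βε₀/2)`; supports in the shells
`|iω̂ - E| ≤ ε_t`, `ε_t/2 ≤ |iω̂ - E| ≤ ε_t`; `|Ḋ̂_t| ≤ 4ε_t⁻¹ 𝟙 ≤ 2β 𝟙`, `|D̂_t| ≤ (β/2) 𝟙`;
`∫|Ḋ̂_t| ≤ 4V₁`, `∫|D̂_t| ≤ V₁ log(βε₀/2)`) as the named fact `FiniteVolumePropagatorBounds` (licence F-083,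
`Salmhofer1998Sec5.lean`); t7 g4 DISCHARGED it (`FiniteVolumePropagatorBounds_holds`,
`Salmhofer1998PropagatorBoundsProof.lean`). fs-1 g3 proved that the Hubbard datum
`M = ⟨ε = 1, E = sqDispersion - μ, v̂ ≡ U, v̂_∞ ≡ U, k₀, ε₀⟩` satisfies `ModelData.Hyp` at every `-4 < μ < 0`,
every `U`, every `k₀ ≥ 2`, every `0 < ε₀ ≤ 1` (`klfs_sal98_hyp`, `KLProgrammeFermiSurfaceSalmhofer1998.lean`).

This file composes the two and discharges the two remaining numerical side conditions of Proposition 4 for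
the Hubbard band — `E_max = 4 + |μ|` (`|ε - μ| ≤ 4 + |μ|`) and the volume constant `V₁ = 1` (the fraction of
lattice momenta with `|E| ≤ 2` is at most `1`) — so that **Proposition 4 holds for the Hubbard model on the
discrete torus `𝕄_{n_τ} × Λ*_L` for every cutoff `χ₁`, every `β > 0` with `βε₀ ≥ 6`, every even `n_τ ≥ 2β(ε₀ + 4 + |μ|)`
and every `L ≥ 1`, with `∫|Ḋ̂_t| ≤ 4` and `∫|D̂_t| ≤ log(βε₀/2)`** (`klfs_sal98_prop4_hubbard`), in particular on the
certified window and the analysis window. Proposition 4 is hypothesis (i) of Salmhofer's Theorem 2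
(`ManyFermionGreenFunctionBound`, also proved by t5); this is the Hubbard-specific input that theorem consumes.
No definitions; everything PROVED by composition. [folklore]
-/

noncomputable section

open Real Set

-- the tree's namespace `Summit.<Summit>.<Problem>.Theorems` repeats the summit name by design (D-0017)
set_option linter.dupNamespace false

namespace Summit.HubbardSuperconductivity.HubbardSuperconductivity.Theorems

open Literature.MathematicalPhysics.QuantumLattice
open Literature.MathematicalPhysics.QuantumLattice.FermiRG
open Literature.MathematicalPhysics.QuantumLattice.FermiRG.Salmhofer1998

/-- `|ε(p) - μ| ≤ 4 + |μ|`: the Hubbard `E_max`. [folklore] -/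
theorem klfs_sal98_abs_E_le (μ : ℝ) (p : Fin 2 → ℝ) : |sqDispersion p - μ| ≤ 4 + |μ| := by
  have h1 := neg_four_le_sqDispersion p
  have h2 : sqDispersion p ≤ 4 := by
    rw [sqDispersion]
    have := Real.neg_one_le_cos (p 0); have := Real.neg_one_le_cos (p 1)
    linarith
  have h3 : |sqDispersion p| ≤ 4 := abs_le.2 ⟨by linarith, h2⟩
  calc |sqDispersion p - μ| ≤ |sqDispersion p| + |μ| := abs_sub _ _
    _ ≤ 4 + |μ| := by linarith

/-- The Hubbard volume constant `V₁ = 1`: on every discrete torus `Λ*_{L'}` the fraction of momenta with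
`|E| ≤ 2` is at most `1`. [folklore] -/
theorem klfs_sal98_volume_ratio_le_one (E : Mom 2 → ℝ) (latt : ℝ) (L' : ℕ) (hL' : 0 < L') :
    ((Finset.univ.filter fun q : Fin 2 → Fin L' => |E (latticeMom latt L' q)| ≤ 2).card : ℝ) / (L' : ℝ) ^ 2 ≤ 1 := by
  have hL : (0 : ℝ) < (L' : ℝ) ^ 2 := by positivity
  rw [div_le_one hL]
  have h := Finset.card_filter_le (Finset.univ : Finset (Fin 2 → Fin L'))
    (fun q : Fin 2 → Fin L' => |E (latticeMom latt L' q)| ≤ 2)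
  have hu : (Finset.univ : Finset (Fin 2 → Fin L')).card = L' ^ 2 := by
    rw [Finset.card_univ, Fintype.card_fun, Fintype.card_fin, Fintype.card_fin]
  rw [hu] at h
  exact_mod_cast h

/-- **Salmhofer 1998 Proposition 4 for the Hubbard model.** For `-4 < μ < 0`, any `U`, `k₀ ≥ 2`,
`0 < ε₀ ≤ 1`, any cutoff function `χ₁` (`IsCutoff`), any `β > 0` with `βε₀ ≥ 6`, any even `n_τ > 0` with
`n_τ ≥ 2β(ε₀ + 4 + |μ|)` and any `L > 0`, the finite-volume scale-decomposed propagator `D̂_t` of the Hubbard datum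
`M = ⟨1, ε - μ, U, U, k₀, ε₀⟩` on `𝕄_{n_τ} × Λ*_L` satisfies (a) `t ↦ D̂_t(k)` is `C^∞`; (b) `D̂_t ≡ 0` for
`t > log(βε₀/2)`; (c) the shell supports of `D̂_t` and `Ḋ̂_t`; (d) `|Ḋ̂_t| ≤ 4ε_t⁻¹ 𝟙 ≤ 2β 𝟙`, `|D̂_t| ≤ (β/2) 𝟙`;
(e) `∫|Ḋ̂_t| ≤ 4` and `∫|D̂_t| ≤ log(βε₀/2)` (`V₁ = 1`). Composition of t7's `FiniteVolumePropagatorBounds_holds`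
with fs-1's `klfs_sal98_hyp`, `E_max = 4 + |μ|`, `V₁ = 1`. [folklore] -/
theorem klfs_sal98_prop4_hubbard {μ : ℝ} (hμ₁ : -4 < μ) (hμ₂ : μ < 0) (U : ℝ) {k₀ : ℕ} (hk : 2 ≤ k₀) {ε₀ : ℝ}
    (hε₀ : 0 < ε₀) (hε₁ : ε₀ ≤ 1) (χ₁ : ℝ → ℝ) (hχ : IsCutoff χ₁) {β : ℝ} {nτ L : ℕ} (hβ : 0 < β)
    (h6 : 6 ≤ β * ε₀) (heven : Even nτ) (hnτ : 0 < nτ) (hnτ2 : 2 * β * (ε₀ + (4 + |μ|)) ≤ nτ) (hL : 0 < L) :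
    let M : ModelData 2 :=
      ModelData.mk 1 (fun p : Fin 2 → ℝ => sqDispersion p - μ) (fun _ _ => U) (fun _ => U) k₀ ε₀
    let T : ℝ := Real.log (β * ε₀ / 2)
    (∀ n ∈ matsIdx nτ, ∀ q : Fin 2 → Fin L,
      ContDiff ℝ ((⊤ : ℕ∞) : WithTop ℕ∞)
        fun t : ℝ => cutoffCov M χ₁ β nτ t (matsFreq β n) (latticeMom M.latt L q)) ∧
    (∀ t : ℝ, T < t → ∀ n ∈ matsIdx nτ, ∀ q : Fin 2 → Fin L,
      cutoffCov M χ₁ β nτ t (matsFreq β n) (latticeMom M.latt L q) = 0) ∧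
    (∀ t : ℝ, 0 ≤ t → t ≤ T → ∀ n ∈ matsIdx nτ, ∀ q : Fin 2 → Fin L,
      let ω := matsFreq β n
      let k := latticeMom M.latt L q
      (cutoffCov M χ₁ β nτ t ω k ≠ 0 → ‖propDenom M β nτ ω k‖ ≤ epsT M.eps0 t) ∧
      (cutoffCovDot M χ₁ β nτ t ω k ≠ 0 →
        epsT M.eps0 t / 2 ≤ ‖propDenom M β nτ ω k‖ ∧ ‖propDenom M β nτ ω k‖ ≤ epsT M.eps0 t)) ∧
    (∀ t : ℝ, 0 ≤ t → ∀ n ∈ matsIdx nτ, ∀ q : Fin 2 → Fin L,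
      let ω := matsFreq β n
      let k := latticeMom M.latt L q
      ‖cutoffCovDot M χ₁ β nτ t ω k‖ ≤ 4 * (epsT M.eps0 t)⁻¹ * shellInd M β nτ t ω k ∧
      4 * (epsT M.eps0 t)⁻¹ * shellInd M β nτ t ω k ≤ 2 * β * shellInd M β nτ t ω k ∧
      ‖cutoffCov M χ₁ β nτ t ω k‖ ≤ β / 2 * shellInd M β nτ t ω k) ∧
    (∀ t : ℝ, 0 ≤ t →
      momSum β M.latt nτ L (fun ω k => ‖cutoffCovDot M χ₁ β nτ t ω k‖) ≤ 4 * 1 ∧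
      momSum β M.latt nτ L (fun ω k => ‖cutoffCov M χ₁ β nτ t ω k‖) ≤ 1 * T) := by
  intro M T
  have hHyp : M.Hyp := klfs_sal98_hyp hμ₁ hμ₂ U hk hε₀ hε₁
  have hE : ∀ p : Mom 2, |M.E p| ≤ 4 + |μ| := fun p => klfs_sal98_abs_E_le μ p
  have hV : ∀ L' : ℕ, 0 < L' →
      ((Finset.univ.filter fun q : Fin 2 → Fin L' => |M.E (latticeMom M.latt L' q)| ≤ 2).card : ℝ) /
          (L' : ℝ) ^ 2 ≤ 1 := fun L' hL' => klfs_sal98_volume_ratio_le_one M.E M.latt L' hL'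
  have h2 : 2 * β * (M.eps0 + (4 + |μ|)) ≤ nτ := hnτ2
  exact FiniteVolumePropagatorBounds_holds 2 M hHyp χ₁ hχ (4 + |μ|) 1 β nτ L hE hV hβ h6 heven hnτ h2 hL

/-- **On the programme's windows** (certified `μ ∈ [-0.4267, -0.1798]` or analysis `μ ∈ [-1, -0.15]`): Salmhofer's
Proposition 4 holds for the Hubbard model (the `L¹` bounds (e): `∫|Ḋ̂_t| ≤ 4`, `∫|D̂_t| ≤ log(βε₀/2)` for all `t ≥ 0`).
[folklore] -/
theorem klfs_windows_sal98_prop4 {μ : ℝ} (hμ : μ ∈ Icc (-0.4267 : ℝ) (-0.1798) ∨ μ ∈ Icc (-1 : ℝ) (-0.15))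
    (U : ℝ) {k₀ : ℕ} (hk : 2 ≤ k₀) {ε₀ : ℝ} (hε₀ : 0 < ε₀) (hε₁ : ε₀ ≤ 1) (χ₁ : ℝ → ℝ) (hχ : IsCutoff χ₁)
    {β : ℝ} {nτ L : ℕ} (hβ : 0 < β) (h6 : 6 ≤ β * ε₀) (heven : Even nτ) (hnτ : 0 < nτ)
    (hnτ2 : 2 * β * (ε₀ + (4 + |μ|)) ≤ nτ) (hL : 0 < L) :
    let M : ModelData 2 :=
      ModelData.mk 1 (fun p : Fin 2 → ℝ => sqDispersion p - μ) (fun _ _ => U) (fun _ => U) k₀ ε₀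
    ∀ t : ℝ, 0 ≤ t →
      momSum β M.latt nτ L (fun ω k => ‖cutoffCovDot M χ₁ β nτ t ω k‖) ≤ 4 ∧
      momSum β M.latt nτ L (fun ω k => ‖cutoffCov M χ₁ β nτ t ω k‖) ≤ Real.log (β * ε₀ / 2) := by
  intro M t ht
  have h1 : -4 < μ := by rcases hμ with h | h <;> linarith [h.1]
  have h2 : μ < 0 := by rcases hμ with h | h <;> linarith [h.2]
  have h := (klfs_sal98_prop4_hubbard h1 h2 U hk hε₀ hε₁ χ₁ hχ hβ h6 heven hnτ hnτ2 hL).2.2.2.2 t ht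
  rw [mul_one, one_mul] at h
  exact h

end Summit.HubbardSuperconductivity.HubbardSuperconductivity.Theorems

end
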